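import Literature.AlgebraicGeometry.Resolution.DChartRoof
import Literature.AlgebraicGeometry.Resolution.FineModels
import HarnessLib

/-!
# The conclusion of Temkin's Thm. 3.3.1 from two charts realized in one valued field (datum-free)

Topic: `Literature/AlgebraicGeometry/Resolution`. M. Temkin, *Inseparable local uniformization*,
J. Algebra 373 (2013) = arXiv:0804.1554v3, Thm. 3.3.1, smooth-fibre case (tree: the named fact
`Temkin2013RelativeCurveSmoothFibre`, the last leaf of `Temkin2013`). Its conclusion
`Temkin2013RelativeCurveConclusion k K k° K° A K₁ K₁°` is a smooth-equivalence over `k°` of the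
centre of `K₁°` on `N = Nr_{K₁}(A′)`, `A′ ≥ A` a finer affine normalized model, with the closed
point of `m°` for a finite separable extension `m` of (a finite purely inseparable extension
`l` of) `k`. `DChartRoof.lean` derives this from a specific chart datum (`RelCurveChart` +
`EData`) with `l = k`; this file records the DATUM-FREE form of that last step, so that any
construction of the two charts can be plugged in — in particular the level-wise construction of
`DESIGN-J2-v2` (constants at a finite purely inseparable level, two Hensel charts, controlled
refinements; at the level itself the purely inseparable extension IS trivial and the level data
descend by `RelativeCurveLevelReduction.lean`):

* `Temkin2013RelativeCurveConclusion.of_charts` — **given**, inside one valued field `(Ω, V)`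
  over `K₁` inducing `K₁°`, a finite separable `m ⊆ Ω` over `k`, a refinement `A′ ≥ A`, a smooth
  `N`-subalgebra `T_A ⊆ O_V` (`N = Nr_{K₁}(A′)`) and a smooth `(O_V ∩ m)`-subalgebra `T_B` of `Ω`
  with `V`-units `s_A ∈ T_A`, `s_B ∈ T_B` such that `T_B ⊆ T_A[1/s_A]` and `T_A ⊆ T_B[1/s_B]`,
  **the conclusion of Thm. 3.3.1 holds** for `(k, K, k°, K°, A, K₁, K₁°)` with `L₁′ = K₁`,
  `l = k`, the constants `m` valued by `V`, and `N = Nr_{K₁}(A′)` — PROVED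
  (`AreSmoothEquivalent.of_charts` of `RoofInField.lean` + the bookkeeping of `DChartRoof.lean`,
  Part IV — `Algebra.Smooth.of_ringEquiv_base` is reused from there — without the datum).

All statements are [folklore] bookkeeping; no definitions, no named facts.

## Sources

* M. Temkin, arXiv:0804.1554v3, proof of Thm. 3.3.1, Steps 3–4 (p. 45) and Definition 2.8.1.
  [Temkin2013]
-/

noncomputable section

open IsLocalRing

namespace Literature.AlgebraicGeometry.Resolution

universe u

section Glue

variable {k K L₁ Ω : Type u} [Field k] [Field K] [Field L₁] [Field Ω]
  [Algebra k K] [Algebra K L₁] [Algebra k L₁] [IsScalarTower k K L₁]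
  [Algebra L₁ Ω] [Algebra k Ω] [IsScalarTower k L₁ Ω]

/-- The valuation ring induced by `V` on `k` is `k°` when it is so through `K` and `L₁`.
[folklore] -/
theorem comap_algebraMap_k_eq {Ok : ValuationSubring k} {O : ValuationSubring K}
    {O₁ : ValuationSubring L₁} {V : ValuationSubring Ω}
    (hO : O.comap (algebraMap k K) = Ok) (hO₁ : O₁.comap (algebraMap K L₁) = O)
    (hV : V.comap (algebraMap L₁ Ω) = O₁) : V.comap (algebraMap k Ω) = Ok := by
  rw [IsScalarTower.algebraMap_eq k L₁ Ω, IsScalarTower.algebraMap_eq k K L₁,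
    ← ValuationSubring.comap_comap, ← ValuationSubring.comap_comap, hV, hO₁, hO]

set_option maxHeartbeats 800000 in
/-- **The conclusion of Thm. 3.3.1 from two charts realized in `(Ω, V)`** (datum-free form of
`RelCurveChart.conclusion`). Data: valuation rings `k° ⊆ K° ⊆ K₁°` induced by `V`
(`hO, hO₁, hV`); an affine normalized model `A′ ≥ A` of `K°` over `k°`; `N = Nr_{K₁}(A′)`; a
finite separable subextension `m ⊆ Ω` of `k`; a smooth `N`-subalgebra `T_A ⊆ O_V` of `Ω`; a
smooth `(O_V ∩ m)`-subalgebra `T_B` of `Ω`; `V`-units `s_A ∈ T_A`, `s_B ∈ T_B` with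
`T_B ⊆ T_A[1/s_A]`, `T_A ⊆ T_B[1/s_B]`. Conclusion: `Temkin2013RelativeCurveConclusion` for
`(k, K, k°, K°, A, K₁, K₁°)`, realized with `L₁′ = K₁`, `l = k` (`⊥`), the constants `m` with
the valuation ring `O_V ∩ m`, and `N`. [cite: Temkin2013, Thm. 3.3.1 (proof, Step 4)] -/
theorem Temkin2013RelativeCurveConclusion.of_charts
    (Ok : ValuationSubring k) (O : ValuationSubring K) (O₁ : ValuationSubring L₁)
    (V : ValuationSubring Ω)
    (hO : O.comap (algebraMap k K) = Ok) (hO₁ : O₁.comap (algebraMap K L₁) = O)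
    (hV : V.comap (algebraMap L₁ Ω) = O₁)
    {A A' : Subring K} (hAA' : A ≤ A')
    (hA' : IsAffineNormalizedModel O (Ok.toSubring.map (algebraMap k K)) A')
    (N : Subring L₁) (hN : N = nrIn (A'.map (algebraMap K L₁)))
    (m : IntermediateField k Ω) [FiniteDimensional k m] [Algebra.IsSeparable k m]
    (TA : Subalgebra N Ω) (hTA : Algebra.Smooth N TA) (hTAV : TA.toSubring ≤ V.toSubring)
    (TB : Subalgebra (V.toSubring ⊓ m.toSubfield.toSubring : Subring Ω) Ω)
    (hTB : Algebra.Smooth (V.toSubring ⊓ m.toSubfield.toSubring : Subring Ω) TB)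
    {sA sB : Ω} (hsA : sA ∈ TA) (hsB : sB ∈ TB)
    (hvA : V.valuation sA = 1) (hvB : V.valuation sB = 1)
    (hAB : (TB : Set Ω) ⊆ locAway TA sA hsA) (hBA : (TA : Set Ω) ⊆ locAway TB sB hsB) :
    Temkin2013RelativeCurveConclusion k K Ok O A L₁ O₁ := by
  classical
  ------------------------------------------------------------------
  -- `N ⊆ K₁°`, `k° → N`
  ------------------------------------------------------------------
  have hR₀O : Ok.toSubring.map (algebraMap k K) ≤ O.toSubring := by
    rintro _ ⟨c, hc, rfl⟩
    have : c ∈ O.comap (algebraMap k K) := by rw [hO]; exact hc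
    exact this
  have hA'O : A' ≤ O.toSubring := (hA'.le_and_le hR₀O).1
  have hR₀A' : Ok.toSubring.map (algebraMap k K) ≤ A' := (hA'.le_and_le hR₀O).2
  have hNO₁ : N ≤ O₁.toSubring := by
    rw [hN]
    exact nrIn_map_le_valuationSubring hA'O O₁ hO₁
  have hkN : ∀ c : Ok, algebraMap k L₁ c ∈ N := fun c => by
    rw [hN, IsScalarTower.algebraMap_apply k K L₁]
    exact le_nrIn _ (Subring.mem_map.mpr ⟨_, hR₀A' (Subring.mem_map.mpr ⟨c, c.2, rfl⟩), rfl⟩)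
  ------------------------------------------------------------------
  -- the constants `m` and their valuation ring `O_V ∩ m`
  ------------------------------------------------------------------
  have hVk : V.comap (algebraMap k Ω) = Ok := comap_algebraMap_k_eq hO hO₁ hV
  let OmV : ValuationSubring m := V.comap (algebraMap m Ω)
  have hOmV : OmV.comap (algebraMap k m) = Ok := by
    show (V.comap (algebraMap m Ω)).comap (algebraMap k m) = Ok
    rw [ValuationSubring.comap_comap, ← IsScalarTower.algebraMap_eq]
    exact hVk
  have hkOm : ∀ c : Ok, algebraMap k m c ∈ OmV := fun c => by
    have : (c : k) ∈ OmV.comap (algebraMap k m) := by rw [hOmV]; exact c.2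
    exact this
  have hmemOm : ∀ z : Ω, z ∈ (V.toSubring ⊓ m.toSubfield.toSubring : Subring Ω) ↔
      z ∈ V ∧ z ∈ m := fun z => Subring.mem_inf
  let eOm : (V.toSubring ⊓ m.toSubfield.toSubring : Subring Ω) ≃+* OmV :=
    { toFun := fun z => ⟨⟨z.1, ((hmemOm z.1).mp z.2).2⟩, ((hmemOm z.1).mp z.2).1⟩
      invFun := fun w => ⟨(w.1 : Ω), (hmemOm _).mpr ⟨w.2, w.1.2⟩⟩
      left_inv := fun _ => rfl
      right_inv := fun _ => rfl
      map_mul' := fun _ _ => rfl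
      map_add' := fun _ _ => rfl }
  -- `T_B` over `OmV`
  let TB' : Subalgebra OmV Ω :=
    { TB.toSubring with
      algebraMap_mem' := fun c => TB.algebraMap_mem (eOm.symm c) }
  haveI : Algebra.Smooth (V.toSubring ⊓ m.toSubfield.toSubring : Subring Ω) TB := hTB
  letI algOmTB' : Algebra (V.toSubring ⊓ m.toSubfield.toSubring : Subring Ω) TB' :=
    (inferInstance : Algebra (V.toSubring ⊓ m.toSubfield.toSubring : Subring Ω) TB)
  haveI : Algebra.Smooth (V.toSubring ⊓ m.toSubfield.toSubring : Subring Ω) TB' := hTB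
  haveI hsmTB' : Algebra.Smooth OmV TB' :=
    Algebra.Smooth.of_ringEquiv_base (D := TB') eOm fun b => Subtype.ext rfl
  haveI hsmTA : Algebra.Smooth N TA := hTA
  ------------------------------------------------------------------
  -- the structure maps from `k°` and the roof
  ------------------------------------------------------------------
  let fN : Ok →+* N := ((algebraMap k L₁).comp Ok.subtype).codRestrict N hkN
  let gOm : Ok →+* OmV := ((algebraMap k m).comp Ok.subtype).codRestrict OmV hkOm
  have hroof : AreSmoothEquivalent fN gOm
      ((maximalIdeal O₁).comap (Subring.inclusion hNO₁)) (maximalIdeal OmV) := by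
    refine AreSmoothEquivalent.of_charts fN gOm (RingHom.ext fun c => ?_) V
      (fun a => mem_comap_maximalIdeal_iff_valuation_lt_one_of_comap_eq V (algebraMap L₁ Ω) O₁
        hV hNO₁ a)
      (fun b => mem_maximalIdeal_iff_valuation_lt_one_of_comap_eq V (algebraMap m Ω) OmV rfl b)
      TA TB' hTAV hsA (show sB ∈ TB' from hsB) hvA hvB (fun w hw => hAB hw) (fun w hw => hBA hw)
    change algebraMap L₁ Ω (algebraMap k L₁ c) = ((algebraMap k m c : m) : Ω)
    rw [← IsScalarTower.algebraMap_apply]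
    exact IsScalarTower.algebraMap_apply k m Ω _
  ------------------------------------------------------------------
  -- the trivial purely inseparable constants `l = ⊥ ⊆ K₁`, acting on `m`
  ------------------------------------------------------------------
  letI algBot : Algebra (⊥ : IntermediateField k L₁) m :=
    ((algebraMap k m).comp (algebraMap (⊥ : IntermediateField k L₁) k)).toAlgebra
  haveI towerKbot : IsScalarTower k (⊥ : IntermediateField k L₁) m :=
    IsScalarTower.of_algebraMap_eq fun c => by
      change algebraMap k m c =
        algebraMap k m (algebraMap (⊥ : IntermediateField k L₁) k (algebraMap k _ c))
      rw [IntermediateField.coe_algebraMap_over_bot, IntermediateField.botEquiv_def]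
  haveI towerBotK : IsScalarTower (⊥ : IntermediateField k L₁) k m :=
    IsScalarTower.of_algebraMap_eq fun _ => rfl
  ------------------------------------------------------------------
  -- the conclusion
  ------------------------------------------------------------------
  refine ⟨A', hAA', hA', L₁, inferInstance, Algebra.id L₁, inferInstance, inferInstance,
    inferInstance, inferInstance, inferInstance, inferInstance, ⊥, inferInstance, inferInstance, ?_,
    O₁, ?_, m, inferInstance, algBot, inferInstance, towerKbot, ?_, ?_, OmV, ?_,
    N, hNO₁, ?_, hkN, hkOm, hroof⟩
  · -- `K₁[⊥] = K₁`
    exact eq_top_iff.mpr fun x _ => (Algebra.adjoin L₁ _).algebraMap_mem x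
  · -- `O₁.comap id = O₁`
    ext x; exact Iff.rfl
  · -- `m` finite over `⊥ ≅ k`
    exact Module.Finite.of_restrictScalars_finite k _ _
  · -- `m` separable over `⊥ ≅ k`
    exact Algebra.isSeparable_tower_top_of_isSeparable k _ _
  · -- `m°` and `K₁°` induce the same valuation ring on `⊥ ≅ k`
    ext c
    obtain ⟨c₀, rfl⟩ : ∃ c₀ : k, algebraMap k _ c₀ = c :=
      ⟨IntermediateField.botEquiv k L₁ c, by
        rw [← IntermediateField.botEquiv_symm, AlgEquiv.symm_apply_apply]⟩
    show algebraMap (⊥ : IntermediateField k L₁) m (algebraMap k _ c₀) ∈ OmV ↔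
      algebraMap (⊥ : IntermediateField k L₁) L₁ (algebraMap k _ c₀) ∈ O₁
    have e1 : algebraMap (⊥ : IntermediateField k L₁) m (algebraMap k _ c₀) = algebraMap k m c₀ :=
      (IsScalarTower.algebraMap_apply k (⊥ : IntermediateField k L₁) m c₀).symm
    have e2 : algebraMap (⊥ : IntermediateField k L₁) L₁ (algebraMap k _ c₀) =
        algebraMap k L₁ c₀ :=
      (IsScalarTower.algebraMap_apply k (⊥ : IntermediateField k L₁) L₁ c₀).symm
    have h1 : algebraMap k m c₀ ∈ OmV ↔ c₀ ∈ Ok := by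
      rw [← ValuationSubring.mem_comap, hOmV]
    have h2 : algebraMap k L₁ c₀ ∈ O₁ ↔ c₀ ∈ Ok := by
      rw [← ValuationSubring.mem_comap, IsScalarTower.algebraMap_eq k K L₁,
        ← ValuationSubring.comap_comap, hO₁, hO]
    rw [e1, e2, h1, h2]
  · -- `N = Nr_{K₁}(A′)` as a set
    rw [hN]; exact coe_nrIn _

end Glue

end Literature.AlgebraicGeometry.Resolution

end
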